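/-
Copyright (c) 2026 the pub-hodgecm-mathlib formalisation cell (harness21).  Prover seat hodgecm-mathlib-K2E4-p14 (g13), R90-TF SLAB section S4
«Ch13.1–2» (base R90-C131, across-lines valve hand), h413 = `stmt-HodgeConjecture-24833`; brick (DICT-Σ) CARD H, hypothesis (F5) of the assembly (S4 dealer K2E2-plan (g8),
R90 bus 2026-09-05T02:43:51Z S4-R49 (3) ∕ 02:44:27Z S4-R50 (1)).
-/
import Summits.HodgeConjecture.HodgeConjecture.Theorems.F0P3cStCharTSTracePairing   -- ★ (F0P3a-p03): `index_centralizer_subgroupOf_normalizer_ne_zero_of_injective` (Harish-Chandra: the Weyl group of a regular element is finite)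
import Summits.HodgeConjecture.HodgeConjecture.Theorems.R90S4TypeOneTorusClasses     -- ★ F3a (R90-C131-p01): the `Gqs L v = U(Φ₃)(L⁺_v)` plumbing of the (DICT) dictionary
import HarnessLib

/-!
# R90-TF · S4 — (DICT-Σ) CARD H `R90S4WeylIndexPosGqs`: for a REGULAR `γ ∈ U(Φ₃)(L⁺_v)` (`v` non-split) the Weyl index `[N(Z(γ)) : Z(γ)]` is a POSITIVE natural number
# (Rogawski 1990, §3.5 p. 28: `Ω_F(T) = N(T)∕T` is finite; Harish-Chandra 1970, Lemma 42)

Cell `hodgecm-mathlib`, crux H413 = `stmt-HodgeConjecture-24833`, route of record `HCCMUnconditional`; R90-TF section S4 (Rogawski Ch. 13.1–2, base `R90-C131`),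
S4 dealer K2E2-plan (g8), hand K2E4-p14 (g13).  CARD H de-risks hypothesis (F5) of K2E3-p31 (g3)'s (DICT-Σ) assembly `stableTransportDictCountT_of_record` for ALL four
Cartan types at once: `0 < [N(↑i) : ↑i]` for every member `↑i = Z(γᵢ)` (`γᵢ` regular) of the Cartan system — `Nat.card`-indices are `0` exactly when infinite, so positivity
IS finiteness of the Weyl group.  THEOREMS ONLY (no `def`, no `instance`, no notation, no named-fact hypothesis, no `sorry`; default heartbeats); ★-only imports; lane
`--supports stmt-HodgeConjecture-24833 --as helper`.

THE MATHEMATICS.  ★ `F0P3cStCharTSTracePairing.index_centralizer_subgroupOf_normalizer_ne_zero_of_injective`: for an injective `ρ : G →* GL_N(K)` (`K` a field) and `g ∈ G` with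
`χ_{ρ g}` separable, `n ↦ ρ(n g n⁻¹)` maps `N(Z(g))` into the FINITE set `{B : B ρ(g) = ρ(g) B, χ_B = χ_{ρ g}}` with fibres the cosets of `Z(g)`, so `[N(Z(g)) : Z(g)] ≠ 0`.  Here
`G = Gqs L v = U(Φ₃)(L⁺_v) ≤ GL₃(L ⊗ L⁺_v)` with `ρ` the (injective) value homomorphism, `K = L ⊗ L⁺_v = L_w` a field because `v` is non-split (★ `LocalRing.isField_of_smul_eq`, the
instance is introduced INSIDE the proofs — the statements are instance-free), and «regular» = «separable characteristic polynomial» (★ `isRegularElt_iff`).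
* `index_centralizer_subgroupOf_normalizer_ne_zero_gqs`, `index_centralizer_subgroupOf_normalizer_pos_gqs` — at a regular `γ`;
* `index_subgroupOf_normalizer_ne_zero_of_mem_cartan`, `index_subgroupOf_normalizer_pos_of_mem_cartan` — for a member `i` of a Cartan system `C` with the CARTAN-ALL letter (2)
  `hZ : ∀ T ∈ C, ∃ γ regular, T = Z(γ)`, in ★ p864386's spelling `((↑i).subgroupOf (Subgroup.normalizer ↑i)).index`.

HONEST LABEL: HC_CM is proved only modulo the 7 printed citations (2 remaining named inputs: hLiu418 = `stmt-HodgeConjecture-24832`, h413 = `stmt-HodgeConjecture-24833`) until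
rung 0 closes; (F5) is a hypothesis of the (DICT-Σ) assembly behind ★ (B2-S) behind the OPEN (W-NP) socket — a ★ helper closes no socket; REL ≠ ★ ≠ BUILT; count-neutral.

## References
* [Rogawski1990] J. D. Rogawski, *Automorphic Representations of Unitary Groups in Three Variables*, Ann. of Math. Stud. 123 (1990), §3.5 p. 28 (`Ω_F(T)`), §3.6 pp. 28–31,
  §12.5 p. 182 (`|Ω_F(T)|∕|Ω(T″)|`).
* [HarishChandra1970] Harish-Chandra, *Harmonic analysis on reductive p-adic groups* (notes by G. van Dijk), LNM 162 (1970), Lemma 42.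
-/

set_option autoImplicit false
-- the mandated namespace repeats the single-problem summit's segment (`HodgeConjecture.HodgeConjecture`)
set_option linter.dupNamespace false

noncomputable section

open NumberField IsDedekindDomain
open Literature.NumberTheory.Automorphic Literature.NumberTheory.Automorphic.UnitaryGroup Literature.NumberTheory.Rogawski1990
open Summit.HodgeConjecture.HodgeConjecture.Cruxes.H413
open scoped MatrixGroups

namespace Summit.HodgeConjecture.HodgeConjecture.R90.S4

section WeylIndex

variable (L : Type) [Field L] [NumberField L] [IsCMField L] (v : HeightOneSpectrum (𝓞 ↥(maximalRealSubfield L)))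

variable {L v}

/-- **`[N(Z(γ)) : Z(γ)] ≠ 0` FOR A REGULAR `γ ∈ U(Φ₃)(L⁺_v)`** (`v` non-split): the Weyl group of the torus `Z(γ)` is finite — ★ Harish-Chandra's Lemma 42 for the injective value
homomorphism `Gqs L v →* GL₃(L_w)` over the field `L_w`. [cite: Rogawski1990, §3.5 p. 28] [cite: HarishChandra1970, Lemma 42] -/
theorem index_centralizer_subgroupOf_normalizer_ne_zero_gqs (hns : ∀ w : PlacesOver L v, IsCMField.complexConj L • w.1 = w.1) {γ : Gqs L v}
    (hreg : IsRegularElt (γ.val : GL (Fin 3) (LocalRing L v))) :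
    ((Subgroup.centralizer ({γ} : Set (Gqs L v))).subgroupOf
      (Subgroup.normalizer ((Subgroup.centralizer ({γ} : Set (Gqs L v)) : Subgroup (Gqs L v)) : Set (Gqs L v)))).index ≠ 0 := by
  obtain ⟨w⟩ := (inferInstance : Nonempty (PlacesOver L v))
  letI : Field (LocalRing L v) := (LocalRing.isField_of_smul_eq (IsCMField.complexConj L) (IsCMField.complexConj_ne_one L) w (hns w)).toField
  -- the injective value homomorphism `U(Φ₃)(L⁺_v) →* GL₃(L ⊗ L⁺_v)`
  let ρ : Gqs L v →* GL (Fin 3) (LocalRing L v) := MonoidHom.mk' (fun g : Gqs L v => (g.val : GL (Fin 3) (LocalRing L v))) fun _ _ => rfl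
  have hρ : Function.Injective ρ := fun a b h => Subtype.ext h
  exact F0P3cStCharTSTracePairing.index_centralizer_subgroupOf_normalizer_ne_zero_of_injective ρ hρ γ ((isRegularElt_iff _).1 hreg)

/-- **`0 < [N(Z(γ)) : Z(γ)]` FOR A REGULAR `γ ∈ U(Φ₃)(L⁺_v)`** (`v` non-split) — hypothesis (F5) of the (DICT-Σ) assembly at the regular generator of a member.
[cite: Rogawski1990, §3.5 p. 28; §12.5 p. 182] [cite: HarishChandra1970, Lemma 42] -/
theorem index_centralizer_subgroupOf_normalizer_pos_gqs (hns : ∀ w : PlacesOver L v, IsCMField.complexConj L • w.1 = w.1) {γ : Gqs L v}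
    (hreg : IsRegularElt (γ.val : GL (Fin 3) (LocalRing L v))) :
    0 < ((Subgroup.centralizer ({γ} : Set (Gqs L v))).subgroupOf
      (Subgroup.normalizer ((Subgroup.centralizer ({γ} : Set (Gqs L v)) : Subgroup (Gqs L v)) : Set (Gqs L v)))).index :=
  Nat.pos_of_ne_zero (index_centralizer_subgroupOf_normalizer_ne_zero_gqs hns hreg)

/-- **`[N(↑i) : ↑i] ≠ 0` FOR EVERY MEMBER OF A CARTAN SYSTEM** (`v` non-split; CARTAN-ALL letter (2): every member is `Z(γ)` for a regular `γ`), in ★ p864386's spelling of the Weyl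
index. [cite: Rogawski1990, §3.5 p. 28; §3.6 p. 28; §12.5 p. 182] [cite: HarishChandra1970, Lemma 42] -/
theorem index_subgroupOf_normalizer_ne_zero_of_mem_cartan (hns : ∀ w : PlacesOver L v, IsCMField.complexConj L • w.1 = w.1) {C : Finset (Subgroup (Gqs L v))}
    (hZ : ∀ T ∈ C, ∃ γ : Gqs L v, IsRegularElt (γ.val : GL (Fin 3) (LocalRing L v)) ∧ T = Subgroup.centralizer ({γ} : Set (Gqs L v))) (i : ↥C) :
    (((i : Subgroup (Gqs L v))).subgroupOf (Subgroup.normalizer ((i : Subgroup (Gqs L v)) : Set (Gqs L v)))).index ≠ 0 := by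
  obtain ⟨γ, hγ, hi⟩ := hZ (i : Subgroup (Gqs L v)) i.2
  rw [hi]
  exact index_centralizer_subgroupOf_normalizer_ne_zero_gqs hns hγ

/-- **`0 < [N(↑i) : ↑i]` FOR EVERY MEMBER OF A CARTAN SYSTEM** (`v` non-split; letter (2) `hZ`) — hypothesis (F5) of K2E3-p31's (DICT-Σ) assembly for all four Cartan types at once,
in ★ p864386's spelling `((↑i).subgroupOf (Subgroup.normalizer ↑i)).index`. [cite: Rogawski1990, §3.5 p. 28; §12.5 p. 182] [cite: HarishChandra1970, Lemma 42] -/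
theorem index_subgroupOf_normalizer_pos_of_mem_cartan (hns : ∀ w : PlacesOver L v, IsCMField.complexConj L • w.1 = w.1) {C : Finset (Subgroup (Gqs L v))}
    (hZ : ∀ T ∈ C, ∃ γ : Gqs L v, IsRegularElt (γ.val : GL (Fin 3) (LocalRing L v)) ∧ T = Subgroup.centralizer ({γ} : Set (Gqs L v))) (i : ↥C) :
    0 < (((i : Subgroup (Gqs L v))).subgroupOf (Subgroup.normalizer ((i : Subgroup (Gqs L v)) : Set (Gqs L v)))).index :=
  Nat.pos_of_ne_zero (index_subgroupOf_normalizer_ne_zero_of_mem_cartan hns hZ i)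

end WeylIndex

end Summit.HodgeConjecture.HodgeConjecture.R90.S4

end
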